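import Summits.NavierStokesRegularity.NavierStokesRegularity.Theorems.ExtremiserTransiencePerFlowEnstrophyContinuity
import Literature.Analysis.FluidPDE.BKMClassVorticitySupLipschitz
import Literature.Analysis.FluidPDE.EnergyToolkit
import HarnessLib

/-!
# Crux `NearExtremalTransiencePerFlow` (stmt-NavierStokesRegularity-26567), LINE g7-β `zone_transversality`:
# tools for stub Z3 `stub_efficiencyContinuous` — continuity in time of the STRETCHING integral and of the SUP-NORM

`--supports stmt-NavierStokesRegularity-26567` (helper file; the stub itself lands in
`Theorems/ExtremiserTransienceNearExtremalTransiencePerFlowStubEfficiencyContinuous.lean`).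

For a classical solution of the unforced Navier–Stokes system on a closed slab `[a,b] × ℝ³` in Tao's smooth `H¹` class
(`u`, `∂ₜu` with all `L²` Sobolev norms bounded — the class delivered on every closed sub-slab of `[0,T)` by
`RungReynoldsOne.stub_taoCover`):
* `exists_norm_sub_le_slab` — pointwise time-Lipschitz velocity `‖u(t,x) − u(s,x)‖ ≤ Λ|t − s|` (time lines
  `IsSmoothSpaceTimeOn.hasDerivWithinAt_timeDerivWithin`, sup bound of `∂ₜu` by Sobolev imbedding
  `exists_forall_norm_iteratedFDeriv_le_bkmClass`, mean value inequality);
* `exists_norm_fderiv_sub_le_slab` — the same for the velocity gradient `Du(t,x)` (`∂ₜ D = D ∂ₜ`,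
  `IsSmoothSpaceTimeOn.timeDerivWithin_fderiv_slice_apply`);
* `exists_abs_iSup_norm_sub_le_slab`, `continuousOn_iSup_norm` — `t ↦ sup_x ‖u(t,x)‖` is Lipschitz on closed slabs,
  continuous on `[0,T)`;
* `continuousOn_stretching_slab`, `continuousOn_stretching` — the vortex-stretching integral
  `J(t) = ∫⟪curl u(t), Du(t) curl u(t)⟫` is Lipschitz on closed slabs and continuous on `[0,T)`: the three-term split
  `⟪ω_t, S_tω_t⟫ − ⟪ω_s, S_sω_s⟫ = ⟪ω_t − ω_s, S_tω_t⟫ + ⟪ω_s, (S_t − S_s)ω_t⟫ + ⟪ω_s, S_s(ω_t − ω_s)⟫`, the weighted AM–GM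
  inequality with weight `|t − s|`, the `L²`-Lipschitz vorticity `IsClassicalNSSolutionOn.exists_lintegral_curl_sub_sq_le`
  and the uniform enstrophy bound of the class.
HONEST FRAMING: time regularity of smooth solutions in a smooth class; nothing about Navier–Stokes regularity or blow-up is
proved; no summit is proved by a line. [folklore]
-/

noncomputable section

open Set Filter Topology MeasureTheory Function
open scoped InnerProductSpace RealInnerProductSpace ENNReal NNReal ContDiff
open Literature.Analysis.FluidPDE

namespace Summit.NavierStokesRegularity.NavierStokesRegularity.Theorems.NearExtremalTransiencePerFlow.ZoneTransversality

-- the summit's namespace `Summit.NavierStokesRegularity.NavierStokesRegularity` repeats the problem name by convention (D-0017)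
set_option linter.dupNamespace false

/-! ### Elementary helpers -/

/-- Weighted AM–GM: `2xy ≤ x²/η + ηy²` for `η > 0`. [folklore] -/
theorem two_mul_le_sq_div_add {x y η : ℝ} (hη : 0 < η) : 2 * x * y ≤ x ^ 2 / η + η * y ^ 2 := by
  rw [show x ^ 2 / η + η * y ^ 2 = (x ^ 2 + η ^ 2 * y ^ 2) / η by field_simp]
  rw [le_div_iff₀ hη]
  nlinarith [sq_nonneg (x - η * y)]

/-- From a finite bound on `∫⁻ ‖f‖ₑ²` for a continuous field: `‖f‖²` is integrable and `∫ ‖f‖² ≤ A.toReal`. [folklore] -/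
theorem integrable_and_integral_sq_le {f : EuclideanSpace ℝ (Fin 3) → EuclideanSpace ℝ (Fin 3)} (hf : Continuous f)
    {A : ℝ≥0∞} (hA : A ≠ ⊤) (h : ∫⁻ x, ‖f x‖ₑ ^ 2 ≤ A) :
    Integrable (fun x => ‖f x‖ ^ 2) ∧ ∫ x, ‖f x‖ ^ 2 ≤ A.toReal := by
  have hint : Integrable (fun x => ‖f x‖ ^ 2) :=
    integrable_sq_norm_of_lintegral_lt_top hf (h.trans_lt hA.lt_top)
  refine ⟨hint, ?_⟩
  rw [integral_eq_lintegral_of_nonneg_ae (ae_of_all _ fun x => sq_nonneg _) hint.aestronglyMeasurable]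
  refine ENNReal.toReal_mono hA (le_trans (le_of_eq (lintegral_congr fun x => ?_)) h)
  rw [ENNReal.ofReal_pow (norm_nonneg _), ofReal_norm]

/-! ### Time-Lipschitz velocity and velocity gradient on a closed slab in Tao's class -/

/-- **Pointwise time-Lipschitz velocity** on a closed slab in the class: `‖u(t,x) − u(s,x)‖ ≤ Λ|t − s|`. [folklore] -/
theorem exists_norm_sub_le_slab {ν a b : ℝ} {u : ℝ → EuclideanSpace ℝ (Fin 3) → EuclideanSpace ℝ (Fin 3)}
    {p : ℝ → EuclideanSpace ℝ (Fin 3) → ℝ} (hS : IsClassicalNSSolutionOn (Icc a b) ν 0 u p)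
    (hBt : HasBoundedSobolevNormsOn (Icc a b) (timeDerivWithin (Icc a b) u)) (hab : a < b) :
    ∃ Λ : ℝ, 0 ≤ Λ ∧ ∀ s ∈ Icc a b, ∀ t ∈ Icc a b, ∀ x, ‖u t x - u s x‖ ≤ Λ * |t - s| := by
  have hU : UniqueDiffOn ℝ (Icc a b) := uniqueDiffOn_Icc hab
  have hWsm : IsSmoothSpaceTimeOn (Icc a b) (timeDerivWithin (Icc a b) u) :=
    hS.smooth_velocity.timeDerivWithin hU
  have hWsl : ∀ t ∈ Icc a b, ContDiff ℝ ∞ (timeDerivWithin (Icc a b) u t) := fun t ht =>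
    hWsm.contDiff_slice ht
  obtain ⟨B₀, hB₀0, hB₀⟩ := exists_forall_norm_iteratedFDeriv_le_bkmClass hWsl hBt 0
  refine ⟨B₀, hB₀0, fun s hs t ht x => ?_⟩
  have hder : ∀ τ ∈ Icc a b, HasDerivWithinAt (fun σ => u σ x) (timeDerivWithin (Icc a b) u τ x) (Icc a b) τ :=
    fun τ hτ => hS.smooth_velocity.hasDerivWithinAt_timeDerivWithin hU hτ x
  have hbd : ∀ τ ∈ Icc a b, ‖timeDerivWithin (Icc a b) u τ x‖ ≤ B₀ := fun τ hτ => by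
    have h := hB₀ τ hτ x
    rwa [norm_iteratedFDeriv_zero] at h
  have h := (convex_Icc a b).norm_image_sub_le_of_norm_hasDerivWithin_le hder hbd hs ht
  rwa [Real.norm_eq_abs] at h

/-- **Pointwise time-Lipschitz velocity gradient** on a closed slab in the class: `‖Du(t,x) − Du(s,x)‖ ≤ Λ|t − s|`.
[folklore] -/
theorem exists_norm_fderiv_sub_le_slab {ν a b : ℝ} {u : ℝ → EuclideanSpace ℝ (Fin 3) → EuclideanSpace ℝ (Fin 3)}
    {p : ℝ → EuclideanSpace ℝ (Fin 3) → ℝ} (hS : IsClassicalNSSolutionOn (Icc a b) ν 0 u p)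
    (hBt : HasBoundedSobolevNormsOn (Icc a b) (timeDerivWithin (Icc a b) u)) (hab : a < b) :
    ∃ Λ : ℝ, 0 ≤ Λ ∧ ∀ s ∈ Icc a b, ∀ t ∈ Icc a b, ∀ x,
      ‖fderiv ℝ (u t) x - fderiv ℝ (u s) x‖ ≤ Λ * |t - s| := by
  have hU : UniqueDiffOn ℝ (Icc a b) := uniqueDiffOn_Icc hab
  have hcl : Icc a b ⊆ closure (interior (Icc a b)) := by
    rw [interior_Icc, closure_Ioo hab.ne]
  have hWsm : IsSmoothSpaceTimeOn (Icc a b) (timeDerivWithin (Icc a b) u) :=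
    hS.smooth_velocity.timeDerivWithin hU
  have hWsl : ∀ t ∈ Icc a b, ContDiff ℝ ∞ (timeDerivWithin (Icc a b) u t) := fun t ht =>
    hWsm.contDiff_slice ht
  obtain ⟨B₁, hB₁0, hB₁⟩ := exists_forall_norm_iteratedFDeriv_le_bkmClass hWsl hBt 1
  refine ⟨B₁, hB₁0, fun s hs t ht x => ?_⟩
  have hder : ∀ τ ∈ Icc a b, HasDerivWithinAt (fun σ => fderiv ℝ (u σ) x)
      (fderiv ℝ (timeDerivWithin (Icc a b) u τ) x) (Icc a b) τ := by
    intro τ hτ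
    have hD : HasDerivWithinAt (fun σ => fderiv ℝ (u σ) x)
        (timeDerivWithin (Icc a b) (fun σ y => fderiv ℝ (u σ) y) τ x) (Icc a b) τ :=
      (hS.smooth_velocity.fderiv_slice hU).hasDerivWithinAt_timeDerivWithin hU hτ x
    have hEq : timeDerivWithin (Icc a b) (fun σ y => fderiv ℝ (u σ) y) τ x =
        fderiv ℝ (timeDerivWithin (Icc a b) u τ) x := by
      refine ContinuousLinearMap.ext fun w => ?_
      have h1 := hS.smooth_velocity.timeDerivWithin_fderiv_slice_apply hU hcl hτ x w
      rw [← h1]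
      have h2 := ((ContinuousLinearMap.apply ℝ (EuclideanSpace ℝ (Fin 3)) w).hasFDerivAt.comp_hasDerivWithinAt
        τ hD).derivWithin (hU τ hτ)
      simp only [ContinuousLinearMap.apply_apply] at h2
      rw [← h2]
      rfl
    rw [hEq] at hD
    exact hD
  have hbd : ∀ τ ∈ Icc a b, ‖fderiv ℝ (timeDerivWithin (Icc a b) u τ) x‖ ≤ B₁ := fun τ hτ => by
    have h := hB₁ τ hτ x
    rwa [← norm_iteratedFDeriv_fderiv, norm_iteratedFDeriv_zero] at h
  have h := (convex_Icc a b).norm_image_sub_le_of_norm_hasDerivWithin_le hder hbd hs ht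
  rwa [Real.norm_eq_abs] at h

/-! ### The sup-norm of the velocity is Lipschitz in time -/

/-- **`t ↦ sup_x ‖u(t,x)‖` is Lipschitz on a closed slab** in the class (slices are bounded by Sobolev imbedding, and
the pointwise time-Lipschitz bound passes to the supremum). [folklore] -/
theorem exists_abs_iSup_norm_sub_le_slab {ν a b : ℝ} {u : ℝ → EuclideanSpace ℝ (Fin 3) → EuclideanSpace ℝ (Fin 3)}
    {p : ℝ → EuclideanSpace ℝ (Fin 3) → ℝ} (hS : IsClassicalNSSolutionOn (Icc a b) ν 0 u p)
    (hB : HasBoundedSobolevNormsOn (Icc a b) u)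
    (hBt : HasBoundedSobolevNormsOn (Icc a b) (timeDerivWithin (Icc a b) u)) (hab : a < b) :
    ∃ Λ : ℝ, 0 ≤ Λ ∧ ∀ s ∈ Icc a b, ∀ t ∈ Icc a b,
      |(⨆ x, ‖u t x‖) - (⨆ x, ‖u s x‖)| ≤ Λ * |t - s| := by
  obtain ⟨Λ, hΛ0, hΛ⟩ := exists_norm_sub_le_slab hS hBt hab
  have hsm : ∀ s ∈ Icc a b, ContDiff ℝ ∞ (u s) := fun s hs => hS.contDiff_velocity hs
  obtain ⟨B₀, hB₀0, hB₀⟩ := exists_forall_norm_iteratedFDeriv_le_bkmClass hsm hB 0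
  have hux : ∀ τ ∈ Icc a b, ∀ x, ‖u τ x‖ ≤ B₀ := fun τ hτ x => by
    have h := hB₀ τ hτ x
    rwa [norm_iteratedFDeriv_zero] at h
  have hbdd : ∀ τ ∈ Icc a b, BddAbove (range fun x => ‖u τ x‖) := fun τ hτ =>
    ⟨B₀, by rintro _ ⟨x, rfl⟩; exact hux τ hτ x⟩
  have key : ∀ s ∈ Icc a b, ∀ t ∈ Icc a b, (⨆ x, ‖u t x‖) ≤ (⨆ x, ‖u s x‖) + Λ * |t - s| := by
    intro s hs t ht
    refine ciSup_le fun x => ?_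
    have h1 : ‖u t x‖ ≤ ‖u s x‖ + ‖u t x - u s x‖ := norm_le_insert' _ _
    have h2 : ‖u s x‖ ≤ ⨆ y, ‖u s y‖ := le_ciSup (hbdd s hs) x
    linarith [hΛ s hs t ht x]
  refine ⟨Λ, hΛ0, fun s hs t ht => abs_sub_le_iff.2 ⟨?_, ?_⟩⟩
  · linarith [key s hs t ht]
  · have h := key t ht s hs
    rw [abs_sub_comm] at h
    linarith

/-- **Continuity of `t ↦ sup_x ‖u(t,x)‖` on `[0,T)`** for a classical solution issued from rapidly decaying Leray–Hopf data
(Tao's class on every closed sub-slab, `RungReynoldsOne.stub_taoCover`). [folklore] -/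
theorem continuousOn_iSup_norm {ν T : ℝ} (hν : 0 < ν) (hT : 0 < T)
    {u : ℝ → EuclideanSpace ℝ (Fin 3) → EuclideanSpace ℝ (Fin 3)} {p : ℝ → EuclideanSpace ℝ (Fin 3) → ℝ}
    (hsol : IsClassicalNSSolutionOn (Ico 0 T) ν 0 u p) (hLH : IsLerayHopfOn T ν 0 (u 0) u)
    (hdec : HasRapidSpatialDecay (u 0)) :
    ContinuousOn (fun t => ⨆ x, ‖u t x‖) (Ico 0 T) := by
  refine DepletionLadder.PerFlow.continuousOn_Ico_of_slabs fun T' hT' => ?_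
  obtain ⟨q, hsolq, hBq, hBtq, -⟩ := RungReynoldsOne.stub_taoCover hν hT hsol hLH hdec hT'
  obtain ⟨Λ, hΛ0, hΛ⟩ := exists_abs_iSup_norm_sub_le_slab hsolq hBq hBtq hT'.1
  have hLip : LipschitzOnWith (Real.toNNReal Λ) (fun t => ⨆ x, ‖u t x‖) (Icc 0 T') := by
    refine LipschitzOnWith.of_dist_le_mul fun s hs t ht => ?_
    rw [Real.dist_eq, Real.dist_eq, Real.coe_toNNReal _ hΛ0]
    exact hΛ t ht s hs
  exact hLip.continuousOn

/-! ### Continuity in time of the vortex-stretching integral -/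

/-- **The stretching integral is Lipschitz on a closed slab** `[0,T]` in the class:
`|J(t) − J(s)| ≤ K|t − s|`, `J(t) = ∫⟪curl u(t), Du(t) curl u(t)⟫`. [folklore] -/
theorem exists_abs_stretching_sub_le_slab {ν T : ℝ} (hT : 0 < T)
    {u : ℝ → EuclideanSpace ℝ (Fin 3) → EuclideanSpace ℝ (Fin 3)} {p : ℝ → EuclideanSpace ℝ (Fin 3) → ℝ}
    (hS : IsClassicalNSSolutionOn (Icc 0 T) ν 0 u p) (hB : HasBoundedSobolevNormsOn (Icc 0 T) u)
    (hBt : HasBoundedSobolevNormsOn (Icc 0 T) (timeDerivWithin (Icc 0 T) u)) :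
    ∃ K : ℝ, 0 ≤ K ∧ ∀ s ∈ Icc 0 T, ∀ t ∈ Icc 0 T,
      |(∫ x, ⟪curl (u t) x, fderiv ℝ (u t) x (curl (u t) x)⟫_ℝ) -
        ∫ x, ⟪curl (u s) x, fderiv ℝ (u s) x (curl (u s) x)⟫_ℝ| ≤ K * |t - s| := by
  have hsm : ∀ s ∈ Icc 0 T, ContDiff ℝ ∞ (u s) := fun s hs => hS.contDiff_velocity hs
  -- uniform gradient bound, gradient time-Lipschitz constant, `L²`-Lipschitz vorticity, enstrophy bound
  obtain ⟨B₁, hB₁0, hB₁⟩ := exists_forall_norm_iteratedFDeriv_le_bkmClass hsm hB 1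
  have hDu : ∀ t ∈ Icc 0 T, ∀ x, ‖fderiv ℝ (u t) x‖ ≤ B₁ := fun t ht x => by
    have h := hB₁ t ht x
    rwa [← norm_iteratedFDeriv_fderiv, norm_iteratedFDeriv_zero] at h
  obtain ⟨Λ₂, hΛ₂0, hΛ₂⟩ := exists_norm_fderiv_sub_le_slab hS hBt hT
  obtain ⟨Λ₁, hΛ₁top, hΛ₁⟩ := hS.exists_lintegral_curl_sub_sq_le hB hT
  obtain ⟨C₁, hC₁⟩ := hB 1
  have hZc : ENNReal.ofReal (‖curlCLM‖ ^ 2) * (C₁ : ℝ≥0∞) ≠ ⊤ :=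
    ENNReal.mul_ne_top ENNReal.ofReal_ne_top ENNReal.coe_ne_top
  have hZl : ∀ t ∈ Icc 0 T, ∫⁻ x, ‖curl (u t) x‖ₑ ^ 2 ≤ ENNReal.ofReal (‖curlCLM‖ ^ 2) * (C₁ : ℝ≥0∞) :=
    fun t ht => (lintegral_curl_sq_le (u t)).trans (mul_le_mul' le_rfl (hC₁ t ht))
  -- real-valued consequences
  have hcω : ∀ t ∈ Icc 0 T, Continuous (curl (u t)) := fun t ht =>
    continuous_curl ((hsm t ht).of_le (by norm_cast))
  have hcD : ∀ t ∈ Icc 0 T, Continuous fun x => fderiv ℝ (u t) x := fun t ht =>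
    (hsm t ht).continuous_fderiv (by simp)
  set Zr : ℝ := (ENNReal.ofReal (‖curlCLM‖ ^ 2) * (C₁ : ℝ≥0∞)).toReal with hZr
  have hZr0 : 0 ≤ Zr := ENNReal.toReal_nonneg
  have hZ : ∀ t ∈ Icc 0 T, Integrable (fun x => ‖curl (u t) x‖ ^ 2) ∧ ∫ x, ‖curl (u t) x‖ ^ 2 ≤ Zr :=
    fun t ht => integrable_and_integral_sq_le (hcω t ht) hZc (hZl t ht)
  set Lr : ℝ := Λ₁.toReal with hLr
  have hLr0 : 0 ≤ Lr := ENNReal.toReal_nonneg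
  have hD : ∀ s ∈ Icc 0 T, ∀ t ∈ Icc 0 T,
      Integrable (fun x => ‖curl (u t) x - curl (u s) x‖ ^ 2) ∧
        ∫ x, ‖curl (u t) x - curl (u s) x‖ ^ 2 ≤ (t - s) ^ 2 * Lr := by
    intro s hs t ht
    have hfin : ENNReal.ofReal ((t - s) ^ 2) * Λ₁ ≠ ⊤ := ENNReal.mul_ne_top ENNReal.ofReal_ne_top hΛ₁top
    have h := integrable_and_integral_sq_le ((hcω t ht).sub (hcω s hs)) hfin (hΛ₁ s hs t ht)
    refine ⟨h.1, h.2.trans (le_of_eq ?_)⟩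
    rw [ENNReal.toReal_mul, ENNReal.toReal_ofReal (sq_nonneg _)]
  -- integrability of the stretching density
  have hF : ∀ t ∈ Icc 0 T, Integrable (fun x => ⟪curl (u t) x, fderiv ℝ (u t) x (curl (u t) x)⟫_ℝ) := by
    intro t ht
    refine ((hZ t ht).1.const_mul B₁).mono' ((hcω t ht).inner ((hcD t ht).clm_apply (hcω t ht))).aestronglyMeasurable
      (ae_of_all _ fun x => ?_)
    rw [Real.norm_eq_abs]
    calc |⟪curl (u t) x, fderiv ℝ (u t) x (curl (u t) x)⟫_ℝ| ≤ ‖curl (u t) x‖ * ‖fderiv ℝ (u t) x (curl (u t) x)‖ :=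
          abs_real_inner_le_norm _ _
      _ ≤ ‖curl (u t) x‖ * (B₁ * ‖curl (u t) x‖) := by
          refine mul_le_mul_of_nonneg_left ?_ (norm_nonneg _)
          exact (ContinuousLinearMap.le_opNorm _ _).trans (mul_le_mul_of_nonneg_right (hDu t ht x) (norm_nonneg _))
      _ = B₁ * ‖curl (u t) x‖ ^ 2 := by ring
  -- the Lipschitz constant
  refine ⟨B₁ * Lr + B₁ * Zr + Λ₂ * Zr, by positivity, fun s hs t ht => ?_⟩
  rcases eq_or_ne t s with hts | hts
  · subst hts; simp
  have hη : 0 < |t - s| := abs_pos.2 (sub_ne_zero.2 hts)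
  set η : ℝ := |t - s| with hηdef
  -- pointwise three-term bound
  have hpt : ∀ x, ‖⟪curl (u t) x, fderiv ℝ (u t) x (curl (u t) x)⟫_ℝ - ⟪curl (u s) x, fderiv ℝ (u s) x (curl (u s) x)⟫_ℝ‖ ≤
      B₁ / η * ‖curl (u t) x - curl (u s) x‖ ^ 2 + (B₁ * η + Λ₂ * η) / 2 * ‖curl (u t) x‖ ^ 2 +
        (B₁ * η + Λ₂ * η) / 2 * ‖curl (u s) x‖ ^ 2 := by
    intro x
    set ωt := curl (u t) x with hωt
    set ωs := curl (u s) x with hωs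
    set St := fderiv ℝ (u t) x with hSt
    set Ss := fderiv ℝ (u s) x with hSs
    have hsplit : ⟪ωt, St ωt⟫_ℝ - ⟪ωs, Ss ωs⟫_ℝ = ⟪ωt - ωs, St ωt⟫_ℝ + ⟪ωs, (St - Ss) ωt⟫_ℝ + ⟪ωs, Ss (ωt - ωs)⟫_ℝ := by
      rw [show (St - Ss) ωt = St ωt - Ss ωt from by simp, map_sub, inner_sub_left, inner_sub_right, inner_sub_right]
      ring
    have hSt' : ‖St‖ ≤ B₁ := hDu t ht x
    have hSs' : ‖Ss‖ ≤ B₁ := hDu s hs x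
    have hSS : ‖St - Ss‖ ≤ Λ₂ * η := hΛ₂ s hs t ht x
    have e1 : |⟪ωt - ωs, St ωt⟫_ℝ| ≤ B₁ * (‖ωt - ωs‖ * ‖ωt‖) := by
      calc |⟪ωt - ωs, St ωt⟫_ℝ| ≤ ‖ωt - ωs‖ * ‖St ωt‖ := abs_real_inner_le_norm _ _
        _ ≤ ‖ωt - ωs‖ * (B₁ * ‖ωt‖) := mul_le_mul_of_nonneg_left
            ((St.le_opNorm _).trans (mul_le_mul_of_nonneg_right hSt' (norm_nonneg _))) (norm_nonneg _)
        _ = B₁ * (‖ωt - ωs‖ * ‖ωt‖) := by ring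
    have e2 : |⟪ωs, (St - Ss) ωt⟫_ℝ| ≤ Λ₂ * η * (‖ωs‖ * ‖ωt‖) := by
      calc |⟪ωs, (St - Ss) ωt⟫_ℝ| ≤ ‖ωs‖ * ‖(St - Ss) ωt‖ := abs_real_inner_le_norm _ _
        _ ≤ ‖ωs‖ * (Λ₂ * η * ‖ωt‖) := mul_le_mul_of_nonneg_left
            (((St - Ss).le_opNorm _).trans (mul_le_mul_of_nonneg_right hSS (norm_nonneg _))) (norm_nonneg _)
        _ = Λ₂ * η * (‖ωs‖ * ‖ωt‖) := by ring
    have e3 : |⟪ωs, Ss (ωt - ωs)⟫_ℝ| ≤ B₁ * (‖ωt - ωs‖ * ‖ωs‖) := by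
      calc |⟪ωs, Ss (ωt - ωs)⟫_ℝ| ≤ ‖ωs‖ * ‖Ss (ωt - ωs)‖ := abs_real_inner_le_norm _ _
        _ ≤ ‖ωs‖ * (B₁ * ‖ωt - ωs‖) := mul_le_mul_of_nonneg_left
            ((Ss.le_opNorm _).trans (mul_le_mul_of_nonneg_right hSs' (norm_nonneg _))) (norm_nonneg _)
        _ = B₁ * (‖ωt - ωs‖ * ‖ωs‖) := by ring
    have a1 : 2 * ‖ωt - ωs‖ * ‖ωt‖ ≤ ‖ωt - ωs‖ ^ 2 / η + η * ‖ωt‖ ^ 2 := two_mul_le_sq_div_add hη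
    have a2 : 2 * ‖ωt - ωs‖ * ‖ωs‖ ≤ ‖ωt - ωs‖ ^ 2 / η + η * ‖ωs‖ ^ 2 := two_mul_le_sq_div_add hη
    have a3 : 2 * ‖ωs‖ * ‖ωt‖ ≤ ‖ωs‖ ^ 2 + ‖ωt‖ ^ 2 := by nlinarith [sq_nonneg (‖ωs‖ - ‖ωt‖)]
    rw [Real.norm_eq_abs, hsplit]
    have habs : |⟪ωt - ωs, St ωt⟫_ℝ + ⟪ωs, (St - Ss) ωt⟫_ℝ + ⟪ωs, Ss (ωt - ωs)⟫_ℝ| ≤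
        |⟪ωt - ωs, St ωt⟫_ℝ| + |⟪ωs, (St - Ss) ωt⟫_ℝ| + |⟪ωs, Ss (ωt - ωs)⟫_ℝ| :=
      (abs_add_le _ _).trans (add_le_add (abs_add_le _ _) le_rfl)
    have hdiv : B₁ / η * ‖ωt - ωs‖ ^ 2 = B₁ * (‖ωt - ωs‖ ^ 2 / η) := by ring
    rw [hdiv]
    nlinarith [e1, e2, e3, mul_le_mul_of_nonneg_left a1 hB₁0, mul_le_mul_of_nonneg_left a2 hB₁0,
      mul_le_mul_of_nonneg_left a3 (mul_nonneg hΛ₂0 hη.le), habs]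
  -- integrate
  have hG : Integrable (fun x => B₁ / η * ‖curl (u t) x - curl (u s) x‖ ^ 2 +
      (B₁ * η + Λ₂ * η) / 2 * ‖curl (u t) x‖ ^ 2 + (B₁ * η + Λ₂ * η) / 2 * ‖curl (u s) x‖ ^ 2) :=
    (((hD s hs t ht).1.const_mul _).add ((hZ t ht).1.const_mul _)).add ((hZ s hs).1.const_mul _)
  have hdiff : (∫ x, ⟪curl (u t) x, fderiv ℝ (u t) x (curl (u t) x)⟫_ℝ) -
      (∫ x, ⟪curl (u s) x, fderiv ℝ (u s) x (curl (u s) x)⟫_ℝ) =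
      ∫ x, (⟪curl (u t) x, fderiv ℝ (u t) x (curl (u t) x)⟫_ℝ - ⟪curl (u s) x, fderiv ℝ (u s) x (curl (u s) x)⟫_ℝ) :=
    (integral_sub (hF t ht) (hF s hs)).symm
  rw [hdiff]
  have hle := norm_integral_le_of_norm_le hG (ae_of_all _ hpt)
  rw [Real.norm_eq_abs] at hle
  refine hle.trans ?_
  have hI1 : Integrable (fun x => B₁ / η * ‖curl (u t) x - curl (u s) x‖ ^ 2) := (hD s hs t ht).1.const_mul _
  have hI2 : Integrable (fun x => (B₁ * η + Λ₂ * η) / 2 * ‖curl (u t) x‖ ^ 2) := (hZ t ht).1.const_mul _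
  have hI3 : Integrable (fun x => (B₁ * η + Λ₂ * η) / 2 * ‖curl (u s) x‖ ^ 2) := (hZ s hs).1.const_mul _
  have hI12 : Integrable (fun x => B₁ / η * ‖curl (u t) x - curl (u s) x‖ ^ 2 +
      (B₁ * η + Λ₂ * η) / 2 * ‖curl (u t) x‖ ^ 2) := hI1.add hI2
  rw [integral_add hI12 hI3, integral_add hI1 hI2, integral_const_mul, integral_const_mul, integral_const_mul]
  have i1 := (hD s hs t ht).2
  have i2 := (hZ t ht).2
  have i3 := (hZ s hs).2
  have hsq : (t - s) ^ 2 = η * η := by rw [hηdef, ← sq, sq_abs]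
  rw [hsq] at i1
  have c1 : B₁ / η * ∫ x, ‖curl (u t) x - curl (u s) x‖ ^ 2 ≤ B₁ * Lr * η := by
    calc B₁ / η * ∫ x, ‖curl (u t) x - curl (u s) x‖ ^ 2 ≤ B₁ / η * (η * η * Lr) :=
          mul_le_mul_of_nonneg_left i1 (div_nonneg hB₁0 hη.le)
      _ = B₁ * Lr * η := by field_simp
  have hc0 : 0 ≤ (B₁ * η + Λ₂ * η) / 2 := by positivity
  have c2 := mul_le_mul_of_nonneg_left i2 hc0
  have c3 := mul_le_mul_of_nonneg_left i3 hc0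
  nlinarith [c1, c2, c3]

/-- **Continuity of the stretching integral on a closed slab** in the class (Lipschitz ⇒ continuous). [folklore] -/
theorem continuousOn_stretching_slab {ν T : ℝ} (hT : 0 < T)
    {u : ℝ → EuclideanSpace ℝ (Fin 3) → EuclideanSpace ℝ (Fin 3)} {p : ℝ → EuclideanSpace ℝ (Fin 3) → ℝ}
    (hS : IsClassicalNSSolutionOn (Icc 0 T) ν 0 u p) (hB : HasBoundedSobolevNormsOn (Icc 0 T) u)
    (hBt : HasBoundedSobolevNormsOn (Icc 0 T) (timeDerivWithin (Icc 0 T) u)) :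
    ContinuousOn (fun t => ∫ x, ⟪curl (u t) x, fderiv ℝ (u t) x (curl (u t) x)⟫_ℝ) (Icc 0 T) := by
  obtain ⟨K, hK0, hK⟩ := exists_abs_stretching_sub_le_slab hT hS hB hBt
  have hLip : LipschitzOnWith (Real.toNNReal K)
      (fun t => ∫ x, ⟪curl (u t) x, fderiv ℝ (u t) x (curl (u t) x)⟫_ℝ) (Icc 0 T) := by
    refine LipschitzOnWith.of_dist_le_mul fun s hs t ht => ?_
    rw [Real.dist_eq, Real.dist_eq, Real.coe_toNNReal _ hK0]
    exact hK t ht s hs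
  exact hLip.continuousOn

/-- **Continuity of the stretching integral on `[0,T)`** for a classical solution issued from rapidly decaying Leray–Hopf
data (Tao's class on every closed sub-slab, `RungReynoldsOne.stub_taoCover`). [folklore] -/
theorem continuousOn_stretching {ν T : ℝ} (hν : 0 < ν) (hT : 0 < T)
    {u : ℝ → EuclideanSpace ℝ (Fin 3) → EuclideanSpace ℝ (Fin 3)} {p : ℝ → EuclideanSpace ℝ (Fin 3) → ℝ}
    (hsol : IsClassicalNSSolutionOn (Ico 0 T) ν 0 u p) (hLH : IsLerayHopfOn T ν 0 (u 0) u)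
    (hdec : HasRapidSpatialDecay (u 0)) :
    ContinuousOn (fun t => ∫ x, ⟪curl (u t) x, fderiv ℝ (u t) x (curl (u t) x)⟫_ℝ) (Ico 0 T) := by
  refine DepletionLadder.PerFlow.continuousOn_Ico_of_slabs fun T' hT' => ?_
  obtain ⟨q, hsolq, hBq, hBtq, -⟩ := RungReynoldsOne.stub_taoCover hν hT hsol hLH hdec hT'
  exact continuousOn_stretching_slab hT'.1 hsolq hBq hBtq

end Summit.NavierStokesRegularity.NavierStokesRegularity.Theorems.NearExtremalTransiencePerFlow.ZoneTransversality

end
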